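import Mathlib.Analysis.SpecialFunctions.Pow.Real
import Literature.Probability.Percolation.MeanFieldBeta
import Summits.CriticalPhenomena.PercolationContinuityZ3.Theorems.PercNearOneGluingNoHeavyQuantThetaOneArmModulus
import HarnessLib

/-!
# (One-arm polynomial decay at `p_c`) ⇒ (explicit Hölder modulus of continuity of `θ` at `p_c⁺`)
# — quant lane, rung R4.b: the reduction (T1) ⇒ (T2) with exponent `2c/(c+d)`

builds on p205010 (kernel theorem, internal audit signed; external expert review pending).
Status sentence for p205010: "θ(p_c) = 0 on ℤ^d, all d ≥ 2 — kernel-verified (Lean 4/Mathlib, standard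
axioms); internal adversarial audit SIGNED 2026-08-20 04:29Z; external expert review pending."

Seat `prim-quant-p4`, helper file `--supports stmt-CriticalPhenomena-4575`; pure proofs, no definitions.
Continuation of `PercNearOneGluingNoHeavyQuantThetaOneArmModulus.lean` (steps 1–4 there).  Here:

5. OURS, CONDITIONAL ((T1) ⇒ (T2), `theta_le_rpow_of_oneArmDecay`, `theta_le_holder_of_oneArmDecay`): if
   `π_{p_c}(n) ≤ C n^{−c}` for `n ≥ 1` (`c > 0`) then, choosing `n = ⌈(p − p_c)^{−2/(c+d)}⌉` in
   `theta_le_sq_sqrt_oneArm_add`,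
   `θ(p) ≤ K · (p − p_c)^{2c/(c+d)}`, `K = (√C + √(2d·3^d/(p_c(1−p))) · 2^{d/2}/2)²` for `p_c < p < 1`,
   and `θ(p) ≤ C' (p − p_c)^{2c/(c+d)}` for ALL `p ≥ p_c` with
   `C' = (√C + √(4d·3^d/(p_c(1−p_c))) · 2^{d/2}/2)² + (2/(1−p_c))^{2c/(c+d)}` (at `p = p_c` this is
   `θ(p_c) = 0`, p205010).  The square root in Grimmett's (2.36)(a) is what doubles the exponent: the
   plain Lipschitz bound `θ_n' ≤ #ℰ` (Grimmett (2.31)) would give `c/(c+d)`.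
6. PRINTED, for comparison (`theta_two_sided_of_oneArmDecay`): the mean-field LOWER bound
   `θ(p) ≥ p − p_c` (Aizenman–Barsky 1987 / Duminil-Copin–Tassion 2016; tree `sub_criticalProb_le_theta`).
   Under (T1) the sandwich `p − p_c ≤ θ(p) ≤ K (p − p_c)^{2c/(c+d)}` forces `c ≤ d` (consistency only).

Honest scope.  The hypothesis (T1) is OPEN in print and in the tree for `3 ≤ d ≤ 6` (for `d = 3` it is
the `@[conjecture]` `Literature.StrongHypotheses.CriticalPhenomena.CriticalOneArmPolyDecayZ3`); these
theorems are unconditional REDUCTIONS, not rates.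

## References
* G. Grimmett, *Percolation*, 2nd ed. (1999), Thm. (2.36)(a), (2.31), §1.4 [GrimmettPercolation1999].
* H. Duminil-Copin, V. Tassion, L'Enseignement Math. 62 (2016) 199–206, Thm. 1.1(2) [DuminilCopinTassionEM2016].
* M. Aizenman, D. J. Barsky, Comm. Math. Phys. 108 (1987) 489–526 (mean-field bound `β ≤ 1`).
-/

noncomputable section

namespace Summit.CriticalPhenomena.PercolationContinuityZ3.Theorems

namespace ThetaModulus

open MeasureTheory Set Filter Topology Literature.Probability.Percolation Literature.Probability.LatticeModels
open scoped Classical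

variable {d : ℕ}

/-! ### §6. An explicit Hölder modulus from an explicit one-arm rate at `p_c` ((T1) ⇒ (T2)) -/

/-- **(T1) ⇒ (T2) with exponent `2c/(c+d)`.**  If the critical one-arm probabilities decay
polynomially, `π_{p_c}(n) ≤ C n^{−c}` (`n ≥ 1`, `c > 0`), then for every `p_c < p < 1`
`θ(p) ≤ ( √C + √(2d·3^d/(p_c(1 − p))) · 2^{d/2}/2 )² · (p − p_c)^{2c/(c+d)}`
(choose `n = ⌈(p − p_c)^{−2/(c+d)}⌉` in `theta_le_sq_sqrt_oneArm_add`).  The hypothesis is the open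
conjecture (T1) (for `d = 3`: `CriticalOneArmPolyDecayZ3`); this theorem is the unconditional
REDUCTION.  New. -/
theorem theta_le_rpow_of_oneArmDecay (hd : 2 ≤ d) {c C : ℝ} (hc : 0 < c) (hC : 0 ≤ C)
    (hdecay : ∀ n : ℕ, 1 ≤ n → oneArmProb d (criticalProbI d) n ≤ C * (n : ℝ) ^ (-c))
    (p : unitInterval) (hpc : (criticalProbI d : ℝ) < p) (hp1 : (p : ℝ) < 1) :
    theta (zdGraph d) 0 p ≤
      (Real.sqrt C + Real.sqrt (2 * d * 3 ^ d / ((criticalProbI d : ℝ) * (1 - p))) *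
          2 ^ ((d : ℝ) / 2) / 2) ^ 2 * ((p : ℝ) - criticalProbI d) ^ (2 * c / (c + d)) := by
  have hpc0 : 0 < (criticalProbI d : ℝ) := by
    rw [coe_criticalProbI]; exact criticalProb_zd_pos d (by omega)
  set pc := (criticalProbI d : ℝ) with hpcdef
  set s := (p : ℝ) - pc with hsdef
  have hs0 : 0 < s := by rw [hsdef]; linarith
  have hs1 : s ≤ 1 := by rw [hsdef]; linarith [p.2.2]
  have hd0 : (0 : ℝ) < d := by exact_mod_cast (show 0 < d by omega)
  have hcd : 0 < c + d := by linarith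
  set α : ℝ := 2 / (c + d) with hα
  have hα0 : 0 < α := div_pos two_pos hcd
  -- the scale
  set N : ℕ := ⌈s ^ (-α)⌉₊ with hNdef
  have hsα : 1 ≤ s ^ (-α) := Real.one_le_rpow_of_pos_of_le_one_of_nonpos hs0 hs1 (by linarith)
  have hsα0 : 0 < s ^ (-α) := Real.rpow_pos_of_pos hs0 _
  have hN1 : 1 ≤ N := Nat.one_le_ceil_iff.2 hsα0
  have hNge : s ^ (-α) ≤ (N : ℝ) := Nat.le_ceil _
  have hNle : (N : ℝ) ≤ 2 * s ^ (-α) := by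
    have := Nat.ceil_lt_add_one hsα0.le
    rw [← hNdef] at this
    linarith
  have hN0 : 0 < (N : ℝ) := by exact_mod_cast (show 0 < N by omega)
  -- §4 at the scale `N`
  have hmain := theta_le_sq_sqrt_oneArm_add d N (criticalProbI d) p hpc0 hpc.le hp1
  set B := Real.sqrt (2 * d * 3 ^ d / (pc * (1 - p))) with hBdef
  -- first summand
  have h1 : Real.sqrt (oneArmProb d (criticalProbI d) N) ≤ Real.sqrt C * s ^ (c / (c + d)) := by
    calc Real.sqrt (oneArmProb d (criticalProbI d) N)
        ≤ Real.sqrt (C * (N : ℝ) ^ (-c)) := Real.sqrt_le_sqrt (hdecay N hN1)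
      _ = Real.sqrt C * Real.sqrt ((N : ℝ) ^ (-c)) := Real.sqrt_mul hC _
      _ = Real.sqrt C * (N : ℝ) ^ (-c / 2) := by
          rw [Real.sqrt_eq_rpow ((N : ℝ) ^ (-c)), ← Real.rpow_mul hN0.le]
          congr 2; ring
      _ ≤ Real.sqrt C * (s ^ (-α)) ^ (-c / 2) :=
          mul_le_mul_of_nonneg_left (Real.rpow_le_rpow_of_nonpos hsα0 hNge (by linarith))
            (Real.sqrt_nonneg C)
      _ = Real.sqrt C * s ^ (c / (c + d)) := by
          rw [← Real.rpow_mul hs0.le]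
          congr 2
          rw [hα]; field_simp
  -- second summand
  have hE := card_boxEdges_le_pow d hN1
  have hden : 0 < pc * (1 - p) := mul_pos hpc0 (by linarith)
  have h2a : Real.sqrt (((box d N).sym2.filter (· ∈ (zdGraph d).edgeSet)).card / (pc * (1 - p))) ≤ B * (N : ℝ) ^ ((d : ℝ) / 2) := by
    calc Real.sqrt (((box d N).sym2.filter (· ∈ (zdGraph d).edgeSet)).card / (pc * (1 - p)))
        ≤ Real.sqrt (2 * d * 3 ^ d * (N : ℝ) ^ d / (pc * (1 - p))) :=
          Real.sqrt_le_sqrt (div_le_div_of_nonneg_right hE hden.le)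
      _ = Real.sqrt (2 * d * 3 ^ d / (pc * (1 - p)) * (N : ℝ) ^ d) := by
          congr 1; ring
      _ = B * Real.sqrt ((N : ℝ) ^ d) := Real.sqrt_mul (by positivity) _
      _ = B * (N : ℝ) ^ ((d : ℝ) / 2) := by
          rw [Real.sqrt_eq_rpow, ← Real.rpow_natCast (N : ℝ) d, ← Real.rpow_mul hN0.le]
          congr 2; ring
  have hNd : (N : ℝ) ^ ((d : ℝ) / 2) ≤ 2 ^ ((d : ℝ) / 2) * s ^ (-((d : ℝ) / (c + d))) := by
    calc (N : ℝ) ^ ((d : ℝ) / 2) ≤ (2 * s ^ (-α)) ^ ((d : ℝ) / 2) :=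
          Real.rpow_le_rpow hN0.le hNle (by positivity)
      _ = 2 ^ ((d : ℝ) / 2) * (s ^ (-α)) ^ ((d : ℝ) / 2) :=
          Real.mul_rpow (by norm_num) hsα0.le
      _ = 2 ^ ((d : ℝ) / 2) * s ^ (-((d : ℝ) / (c + d))) := by
          rw [← Real.rpow_mul hs0.le]
          congr 2
          rw [hα]; field_simp
  have hB0 : 0 ≤ B := Real.sqrt_nonneg _
  have h2 : Real.sqrt (((box d N).sym2.filter (· ∈ (zdGraph d).edgeSet)).card / (pc * (1 - p))) / 2 * s ≤
      B * 2 ^ ((d : ℝ) / 2) / 2 * s ^ (c / (c + d)) := by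
    have hss : s ^ (-((d : ℝ) / (c + d))) * s = s ^ (c / (c + d)) := by
      rw [← Real.rpow_add_one hs0.ne']
      congr 1
      field_simp; ring
    calc Real.sqrt (((box d N).sym2.filter (· ∈ (zdGraph d).edgeSet)).card / (pc * (1 - p))) / 2 * s
        ≤ B * (N : ℝ) ^ ((d : ℝ) / 2) / 2 * s := by
          apply mul_le_mul_of_nonneg_right _ hs0.le
          linarith
      _ ≤ B * (2 ^ ((d : ℝ) / 2) * s ^ (-((d : ℝ) / (c + d)))) / 2 * s := by
          apply mul_le_mul_of_nonneg_right _ hs0.le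
          apply div_le_div_of_nonneg_right _ zero_le_two
          exact mul_le_mul_of_nonneg_left hNd hB0
      _ = B * 2 ^ ((d : ℝ) / 2) / 2 * (s ^ (-((d : ℝ) / (c + d))) * s) := by ring
      _ = B * 2 ^ ((d : ℝ) / 2) / 2 * s ^ (c / (c + d)) := by rw [hss]
  -- combine
  have hsum : Real.sqrt (oneArmProb d (criticalProbI d) N) +
      Real.sqrt (((box d N).sym2.filter (· ∈ (zdGraph d).edgeSet)).card / (pc * (1 - p))) / 2 * s ≤
        (Real.sqrt C + B * 2 ^ ((d : ℝ) / 2) / 2) * s ^ (c / (c + d)) := by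
    rw [add_mul]; exact add_le_add h1 h2
  have hnn : 0 ≤ Real.sqrt (oneArmProb d (criticalProbI d) N) +
      Real.sqrt (((box d N).sym2.filter (· ∈ (zdGraph d).edgeSet)).card / (pc * (1 - p))) / 2 * s := by
    have := Real.sqrt_nonneg (((box d N).sym2.filter (· ∈ (zdGraph d).edgeSet)).card / (pc * (1 - p)))
    positivity
  calc theta (zdGraph d) 0 p
      ≤ (Real.sqrt (oneArmProb d (criticalProbI d) N) +
          Real.sqrt (((box d N).sym2.filter (· ∈ (zdGraph d).edgeSet)).card / (pc * (1 - p))) / 2 * s) ^ 2 := hmain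
    _ ≤ ((Real.sqrt C + B * 2 ^ ((d : ℝ) / 2) / 2) * s ^ (c / (c + d))) ^ 2 :=
        pow_le_pow_left₀ hnn hsum 2
    _ = (Real.sqrt C + B * 2 ^ ((d : ℝ) / 2) / 2) ^ 2 * s ^ (2 * c / (c + d)) := by
        rw [mul_pow, ← Real.rpow_natCast (s ^ (c / (c + d))) 2, ← Real.rpow_mul hs0.le]
        congr 2
        push_cast; ring

/-- **Two-sided bounds under (T1)** — the mean-field LOWER bound is a tree theorem
(`sub_criticalProb_le_theta`, from Duminil-Copin–Tassion 2016 / Aizenman–Barsky 1987: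
`θ(p) ≥ p − p_c`), the upper bound is `theta_le_rpow_of_oneArmDecay`: for `p_c < p < 1`,
`p − p_c ≤ θ(p) ≤ K_d(C, p) · (p − p_c)^{2c/(c+d)}`.  Conditional on (T1); new as a statement.
[cite: DuminilCopinTassionEM2016, Thm. 1.1(2)] -/
theorem theta_two_sided_of_oneArmDecay (hd : 2 ≤ d) {c C : ℝ} (hc : 0 < c) (hC : 0 ≤ C)
    (hdecay : ∀ n : ℕ, 1 ≤ n → oneArmProb d (criticalProbI d) n ≤ C * (n : ℝ) ^ (-c))
    (p : unitInterval) (hpc : (criticalProbI d : ℝ) < p) (hp1 : (p : ℝ) < 1) :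
    (p : ℝ) - criticalProbI d ≤ theta (zdGraph d) 0 p ∧
      theta (zdGraph d) 0 p ≤
        (Real.sqrt C + Real.sqrt (2 * d * 3 ^ d / ((criticalProbI d : ℝ) * (1 - p))) *
            2 ^ ((d : ℝ) / 2) / 2) ^ 2 * ((p : ℝ) - criticalProbI d) ^ (2 * c / (c + d)) :=
  ⟨by rw [coe_criticalProbI]; exact sub_criticalProb_le_theta hd p (by rw [← coe_criticalProbI]; exact hpc.le),
    theta_le_rpow_of_oneArmDecay hd hc hC hdecay p hpc hp1⟩

/-- **Global Hölder form of (T1) ⇒ (T2)** (the shape `θ(p) ≤ C' (p − p_c)^b` for ALL `p ≥ p_c`, as in the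
lane's `ThetaHolderNearCritical`): under the one-arm decay hypothesis, for every `p ≥ p_c`,
`θ(p) ≤ C' · (p − p_c)^{2c/(c+d)}` with the explicit constant
`C' = ( √C + √(4d·3^d/(p_c(1 − p_c))) · 2^{d/2}/2 )² + (2/(1 − p_c))^{2c/(c+d)}`
(first summand: `theta_le_rpow_of_oneArmDecay` on `p ≤ (1+p_c)/2`; second: `θ ≤ 1` on `p ≥ (1+p_c)/2`;
at `p = p_c` the bound is `θ(p_c) = 0`, p205010).  Conditional on (T1); the reduction is new.
builds on p205010 (kernel theorem, internal audit signed; external expert review pending). -/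
theorem theta_le_holder_of_oneArmDecay (hd : 2 ≤ d) {c C : ℝ} (hc : 0 < c) (hC : 0 ≤ C)
    (hdecay : ∀ n : ℕ, 1 ≤ n → oneArmProb d (criticalProbI d) n ≤ C * (n : ℝ) ^ (-c))
    (p : unitInterval) (hpc : (criticalProbI d : ℝ) ≤ p) :
    theta (zdGraph d) 0 p ≤
      ((Real.sqrt C + Real.sqrt (4 * d * 3 ^ d / ((criticalProbI d : ℝ) * (1 - criticalProbI d))) *
          2 ^ ((d : ℝ) / 2) / 2) ^ 2 + (2 / (1 - (criticalProbI d : ℝ))) ^ (2 * c / (c + d))) *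
        ((p : ℝ) - criticalProbI d) ^ (2 * c / (c + d)) := by
  have hpc0 : 0 < (criticalProbI d : ℝ) := by
    rw [coe_criticalProbI]; exact criticalProb_zd_pos d (by omega)
  have hpc1 : (criticalProbI d : ℝ) < 1 := by
    rw [coe_criticalProbI]; exact criticalProb_zd_lt_one hd
  set pc := (criticalProbI d : ℝ) with hpcdef
  set b : ℝ := 2 * c / (c + d) with hb
  have hd0 : (0 : ℝ) < d := by exact_mod_cast (show 0 < d by omega)
  have hb0 : 0 < b := by rw [hb]; positivity
  set K₁ := (Real.sqrt C + Real.sqrt (4 * d * 3 ^ d / (pc * (1 - pc))) * 2 ^ ((d : ℝ) / 2) / 2) ^ 2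
    with hK₁
  set K₂ := (2 / (1 - pc)) ^ b with hK₂
  have hK₁0 : 0 ≤ K₁ := sq_nonneg _
  have hK₂0 : 0 ≤ K₂ := Real.rpow_nonneg (div_nonneg zero_le_two (by linarith)) _
  have hs0 : 0 ≤ (p : ℝ) - pc := by rw [hpcdef]; linarith
  have hsb0 : 0 ≤ ((p : ℝ) - pc) ^ b := Real.rpow_nonneg hs0 _
  rcases hpc.eq_or_lt with heq | hlt
  · -- `p = p_c`: `θ(p_c) = 0`
    have hp' : p = criticalProbI d := Subtype.ext heq.symm
    have h0 : theta (zdGraph d) 0 p = 0 := by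
      rw [hp']; exact CSH.percolationContinuity_allDimensions d hd
    rw [h0]
    exact mul_nonneg (add_nonneg hK₁0 hK₂0) hsb0
  by_cases hmid : (p : ℝ) ≤ (1 + pc) / 2
  · -- near `p_c`: the rate theorem with `1 - p ≥ (1 - p_c)/2`
    have hp1 : (p : ℝ) < 1 := by linarith
    have hrate := theta_le_rpow_of_oneArmDecay hd hc hC hdecay p hlt hp1
    have hKp : (Real.sqrt C + Real.sqrt (2 * d * 3 ^ d / (pc * (1 - p))) * 2 ^ ((d : ℝ) / 2) / 2) ^ 2
        ≤ K₁ := by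
      have hfrac : 2 * d * 3 ^ d / (pc * (1 - p)) ≤ 4 * d * 3 ^ d / (pc * (1 - pc)) := by
        rw [div_le_div_iff₀ (mul_pos hpc0 (by linarith)) (mul_pos hpc0 (by linarith))]
        have h3 : (0 : ℝ) ≤ 2 * d * 3 ^ d * pc := by positivity
        nlinarith
      have hsq : Real.sqrt (2 * d * 3 ^ d / (pc * (1 - p))) ≤
          Real.sqrt (4 * d * 3 ^ d / (pc * (1 - pc))) := Real.sqrt_le_sqrt hfrac
      have hnn : 0 ≤ Real.sqrt C + Real.sqrt (2 * d * 3 ^ d / (pc * (1 - p))) * 2 ^ ((d : ℝ) / 2) / 2 := by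
        positivity
      apply pow_le_pow_left₀ hnn
      have h2d : (0 : ℝ) ≤ 2 ^ ((d : ℝ) / 2) / 2 := by positivity
      nlinarith
    calc theta (zdGraph d) 0 p
        ≤ (Real.sqrt C + Real.sqrt (2 * d * 3 ^ d / (pc * (1 - p))) * 2 ^ ((d : ℝ) / 2) / 2) ^ 2 *
            ((p : ℝ) - pc) ^ b := hrate
      _ ≤ K₁ * ((p : ℝ) - pc) ^ b := mul_le_mul_of_nonneg_right hKp hsb0
      _ ≤ (K₁ + K₂) * ((p : ℝ) - pc) ^ b := by nlinarith
  · -- far from `p_c`: `θ ≤ 1 ≤ K₂ (p - p_c)^b`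
    push Not at hmid
    have hge1 : 1 ≤ 2 / (1 - pc) * ((p : ℝ) - pc) := by
      rw [div_mul_eq_mul_div, le_div_iff₀ (by linarith)]
      linarith
    have hK₂s : 1 ≤ K₂ * ((p : ℝ) - pc) ^ b := by
      rw [hK₂, ← Real.mul_rpow (div_nonneg zero_le_two (by linarith)) hs0]
      exact Real.one_le_rpow hge1 hb0.le
    calc theta (zdGraph d) 0 p ≤ 1 := theta_le_one _ _ _
      _ ≤ K₂ * ((p : ℝ) - pc) ^ b := hK₂s
      _ ≤ (K₁ + K₂) * ((p : ℝ) - pc) ^ b := by nlinarith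

end ThetaModulus

end Summit.CriticalPhenomena.PercolationContinuityZ3.Theorems
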